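import Mathlib
import Summits.Ventures.PercRepro2.Defs
import Summits.Ventures.PercRepro2.Graph
import Summits.Ventures.PercRepro2.Events
import Summits.Ventures.PercRepro2.Induced
import Summits.Ventures.PercRepro2.Frontier
import Summits.Ventures.PercRepro2.BHKEvents
import Summits.Ventures.PercRepro2.BTVFamilyDefs
import Summits.Ventures.PercRepro2.BlockConn

/-!
# The block family: the four cells (blind cell PercRepro2, mine-1 g53;
paper proofs/MINE1-BLOCKS.md §1, §2.3 (F1), (F2), (F2′), (F2″))

The multi-terminal version of the merged V-family of `BTVFamilyDefs.lean`: a set `Vs` of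
observed `v`-vertices, a plain `u`-frontier `A` on the side of `a = NST`, a BLOCK STRUCTURE `𝒰`
on the side of `b = STN` («every block reached by `s`, the blocks contracted»: `ConnB` of
`BlockConn.lean`), the join `j = SSN` with the blocks `𝒰` inside a frontier `A ⊇ ⋃𝒰` whose other
vertices are FREE (avoided by `t` and by `W`, not required in `C_s`), the meet `m = NTT` with a
plain frontier.  On the induced subgraph `G[U]`:

  `a(A,W) = {Vs ↔ s, t ↔ W, s ↮ {t} ∪ A ∪ W, t ↮ A, W ↮ A}`
  `b(𝒰,W) = {s ↔_𝒰 B (each block), Vs ↔ t, t ↮ {s} ∪ ⋃𝒰 ∪ W, s ↮ W, ⋃𝒰 ↮ W}`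
  `j(A,𝒰,W) = {s ↔_𝒰 B (each block), v ↔_𝒰 s (v ∈ Vs), t ↮ {s} ∪ A ∪ W, ({s} ∪ A) ↮ W}`
  `m(A,W) = {t ↔ W, v ↔ {t} ∪ W (v ∈ Vs), s ↮ {t} ∪ A ∪ W, ({t} ∪ W) ↮ A}`.

This file defines them, proves the degenerate cases, the monotonicities (`m` antitone in `A`,
`j` antitone in `W`, `j` MONOTONE under refining the blocks inside the frontier (F2′), and the
GLUE inclusion (F2″): the cell `j` of `G[U ∖ z]` with `z` replaced by its open neighbours lies in
the cell `j` of `G[U]`), and the transfer lemmas for contracted connections (an avoided vertex;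
the fibre of an explored cluster).
-/

namespace Summit.Ventures.PercRepro2

namespace BlockFamily

open BTVFamily

/-! ## Transfer lemmas: a vertex avoided by the sources, and the fibre of an explored cluster -/

section Transfer

variable {V : Type*} {E : Type*} [DecidableEq V] {ends : E → Sym2 V} {U : Finset V} {z : V}
  {ω : Config E} {𝒰 : Finset (Finset V)}

/-- **Transfer at an avoided vertex**: if neither `x` nor any block vertex is plainly connected
to `z` in `G[U]`, a contracted connection from `x` in `G[U]` is one in `G[U ∖ z]` (same blocks). -/
lemma connB_sdiff_of_avoid {x : V} (hx : ¬ Conn ends (induced ends (↑U) ω) x z)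
    (h𝒰 : ∀ B ∈ 𝒰, ∀ b ∈ B, ¬ Conn ends (induced ends (↑U) ω) b z) {y : V}
    (h : ConnB ends (induced ends (↑U) ω) 𝒰 x y) :
    ConnB ends (induced ends (↑(U \ {z})) ω) 𝒰 x y := by
  have key : ConnB ends (induced ends (↑(U \ {z})) ω) 𝒰 x y ∧
      ¬ Conn ends (induced ends (↑U) ω) y z := by
    refine connB_induction (P := fun y => ConnB ends (induced ends (↑(U \ {z})) ω) 𝒰 x y ∧
      ¬ Conn ends (induced ends (↑U) ω) y z) ⟨connB_refl x, hx⟩ ?_ h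
    rintro b y _ ⟨hxb, hbz⟩ hby
    rcases hby with hby | ⟨B, hB, hbB, hyB⟩
    · refine ⟨connB_trans hxb (connB_of_conn ?_), fun hyz => hbz (conn_trans hby hyz)⟩
      exact conn_induced_sdiff_of_conn (Z := {z})
        (fun z' hz' => by rw [Finset.mem_singleton] at hz'; rw [hz']; exact hbz) hby
    · exact ⟨connB_trans hxb (connB_of_mem_block hB hbB hyB), h𝒰 B hB y hyB⟩
  exact key.1

/-- Contracted connections in `G[U ∖ z]` are contracted connections in `G[U]`. -/
lemma connB_of_sdiff {x y : V} (h : ConnB ends (induced ends (↑(U \ {z})) ω) 𝒰 x y) :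
    ConnB ends (induced ends (↑U) ω) 𝒰 x y :=
  connB_mono_config (induced_mono_set (Finset.coe_subset.2 Finset.sdiff_subset) ω) h

omit [DecidableEq V] in
/-- **Transfer to the fibre of an explored cluster**: if `x` and every block vertex lie outside the
cluster `L` of `t`, a contracted connection from `x` in `ω` is one in `G ∖ L`. -/
lemma connB_delConfig_of_avoid {t x : V} (hx : x ∉ cluster ends ω t)
    (h𝒰 : ∀ B ∈ 𝒰, ∀ b ∈ B, b ∉ cluster ends ω t) {y : V} (h : ConnB ends ω 𝒰 x y) :
    ConnB ends (delConfig ends (cluster ends ω t) ω) 𝒰 x y := by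
  have key : ConnB ends (delConfig ends (cluster ends ω t) ω) 𝒰 x y ∧ y ∉ cluster ends ω t := by
    refine connB_induction (P := fun y => ConnB ends (delConfig ends (cluster ends ω t) ω) 𝒰 x y ∧
      y ∉ cluster ends ω t) ⟨connB_refl x, hx⟩ ?_ h
    rintro b y _ ⟨hxb, hbL⟩ hby
    rcases hby with hby | ⟨B, hB, hbB, hyB⟩
    · have hyL : y ∉ cluster ends ω t := fun hy => hbL (conn_trans hy (conn_symm hby))
      refine ⟨connB_trans hxb (connB_of_conn ?_), hyL⟩
      have e := cluster_delConfig_cluster (ends := ends) (ω := ω) (s := t) (t := b) hbL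
      have : y ∈ cluster ends (delConfig ends (cluster ends ω t) ω) b := by
        rw [e]; exact hby
      exact this
    · exact ⟨connB_trans hxb (connB_of_mem_block hB hbB hyB), h𝒰 B hB y hyB⟩
  exact key.1

omit [DecidableEq V] in
/-- Closing the edges touching `W` gives a smaller configuration. -/
lemma delConfig_le (W : Set V) (ω : Config E) : delConfig ends W ω ≤ ω := by
  intro e
  by_cases he : e ∈ touches ends W
  · rw [delConfig_apply_of_mem he]
    exact Bool.false_le _
  · rw [delConfig_apply_of_notMem he]

omit [DecidableEq V] in
/-- Contracted connections in the fibre are contracted connections in the whole configuration. -/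
lemma connB_of_delConfig {W : Set V} {x y : V}
    (h : ConnB ends (delConfig ends W ω) 𝒰 x y) : ConnB ends ω 𝒰 x y :=
  connB_mono_config (delConfig_le W ω) h

end Transfer

/-! ## The union of the blocks -/

section UnionB

variable {V : Type*} [DecidableEq V]

/-- The union of the blocks. -/
def unionB (𝒰 : Finset (Finset V)) : Finset V := 𝒰.biUnion id

/-- Membership in the union of the blocks. -/
lemma mem_unionB {𝒰 : Finset (Finset V)} {x : V} : x ∈ unionB 𝒰 ↔ ∃ B ∈ 𝒰, x ∈ B := by
  simp [unionB]

/-- A block lies in the union of the blocks. -/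
lemma subset_unionB {𝒰 : Finset (Finset V)} {B : Finset V} (hB : B ∈ 𝒰) : B ⊆ unionB 𝒰 :=
  fun _ hx => mem_unionB.2 ⟨B, hB, hx⟩

/-- The union of the revealed blocks: `z` removed, the revealed set added. -/
lemma unionB_revealBlocks (𝒰 : Finset (Finset V)) (z : V) (F : Finset V) :
    unionB (revealBlocks 𝒰 z F) = (unionB 𝒰).erase z ∪ F := by
  ext x
  simp only [mem_unionB, mem_revealBlocks, Finset.mem_union, Finset.mem_erase, mergedBlock]
  constructor
  · rintro ⟨B, (⟨hB, hzB⟩ | rfl), hx⟩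
    · exact Or.inl ⟨fun h => hzB (h ▸ hx), B, hB, hx⟩
    · rcases Finset.mem_union.1 hx with hx | hx
      · rw [Finset.mem_erase, Finset.mem_biUnion] at hx
        obtain ⟨hxz, B, hB, hxB⟩ := hx
        exact Or.inl ⟨hxz, B, (Finset.mem_filter.1 hB).1, hxB⟩
      · exact Or.inr hx
  · rintro (⟨hxz, B, hB, hx⟩ | hx)
    · by_cases hzB : z ∈ B
      · refine ⟨_, Or.inr rfl, Finset.mem_union_left _ ?_⟩
        rw [Finset.mem_erase, Finset.mem_biUnion]
        exact ⟨hxz, B, Finset.mem_filter.2 ⟨hB, hzB⟩, hx⟩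
      · exact ⟨B, Or.inl ⟨hB, hzB⟩, hx⟩
    · exact ⟨_, Or.inr rfl, Finset.mem_union_right _ hx⟩

/-- Under refinement of the blocks the union is preserved in the obvious direction. -/
lemma unionB_subset_of_refines {𝒰 𝒰' : Finset (Finset V)} (h : ∀ B ∈ 𝒰, ∃ B' ∈ 𝒰', B ⊆ B') :
    unionB 𝒰 ⊆ unionB 𝒰' := by
  intro x hx
  obtain ⟨B, hB, hxB⟩ := mem_unionB.1 hx
  obtain ⟨B', hB', hBB'⟩ := h B hB
  exact mem_unionB.2 ⟨B', hB', hBB' hxB⟩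

end UnionB

/-! ## The four cells -/

section Cells

variable {V : Type*} {E : Type*} [DecidableEq V]

/-- The cell `NST`: `u ~ A` in neither cluster, `Vs ⊆ C_s`, `w ~ W` in `C_t`. -/
def aProp (ends : E → Sym2 V) (s t : V) (Vs A W : Finset V) (ω : Config E) : Prop :=
  (∀ v ∈ Vs, Conn ends ω v s) ∧ ConnSet ends ω {t} W ∧ ¬ ConnSet ends ω {s} ({t} ∪ A ∪ W) ∧
    ¬ ConnSet ends ω {t} A ∧ ¬ ConnSet ends ω W A

/-- The cell `STN` with blocks: every block reached by `s` (blocks contracted), `Vs ⊆ C_t`,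
`w ~ W` in neither cluster. -/
def bProp (ends : E → Sym2 V) (s t : V) (Vs : Finset V) (𝒰 : Finset (Finset V)) (W : Finset V)
    (ω : Config E) : Prop :=
  (∀ B ∈ 𝒰, ConnSetB ends ω 𝒰 {s} B) ∧ (∀ v ∈ Vs, Conn ends ω v t) ∧
    ¬ ConnSet ends ω {t} ({s} ∪ unionB 𝒰 ∪ W) ∧ ¬ ConnSet ends ω {s} W ∧
      ¬ ConnSet ends ω (unionB 𝒰) W

/-- The cell `SSN` with blocks inside the frontier `A`: every block reached by `s`, `Vs` in the
contracted cluster of `s`, `t` avoids `{s} ∪ A ∪ W`, `W` avoids `{s} ∪ A`. -/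
def jProp (ends : E → Sym2 V) (s t : V) (Vs A : Finset V) (𝒰 : Finset (Finset V)) (W : Finset V)
    (ω : Config E) : Prop :=
  (∀ B ∈ 𝒰, ConnSetB ends ω 𝒰 {s} B) ∧ (∀ v ∈ Vs, ConnB ends ω 𝒰 v s) ∧
    ¬ ConnSet ends ω {t} ({s} ∪ A ∪ W) ∧ ¬ ConnSet ends ω ({s} ∪ A) W

/-- The cell `NTT`: `u ~ A` in neither cluster, `Vs ⊆ C_t`, `w ~ W` in `C_t`. -/
def mProp (ends : E → Sym2 V) (s t : V) (Vs A W : Finset V) (ω : Config E) : Prop :=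
  ConnSet ends ω {t} W ∧ (∀ v ∈ Vs, ConnSet ends ω {v} ({t} ∪ W)) ∧
    ¬ ConnSet ends ω {s} ({t} ∪ A ∪ W) ∧ ¬ ConnSet ends ω ({t} ∪ W) A

/-- The cell `a` on the induced subgraph `G[U]`. -/
def aEv (ends : E → Sym2 V) (U : Finset V) (s t : V) (Vs A W : Finset V) : Set (Config E) :=
  {ω | aProp ends s t Vs A W (induced ends (↑U) ω)}

/-- The cell `b` on `G[U]`. -/
def bEv (ends : E → Sym2 V) (U : Finset V) (s t : V) (Vs : Finset V) (𝒰 : Finset (Finset V))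
    (W : Finset V) : Set (Config E) :=
  {ω | bProp ends s t Vs 𝒰 W (induced ends (↑U) ω)}

/-- The cell `j` on `G[U]`. -/
def jEv (ends : E → Sym2 V) (U : Finset V) (s t : V) (Vs A : Finset V) (𝒰 : Finset (Finset V))
    (W : Finset V) : Set (Config E) :=
  {ω | jProp ends s t Vs A 𝒰 W (induced ends (↑U) ω)}

/-- The cell `m` on `G[U]`. -/
def mEv (ends : E → Sym2 V) (U : Finset V) (s t : V) (Vs A W : Finset V) : Set (Config E) :=
  {ω | mProp ends s t Vs A W (induced ends (↑U) ω)}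

variable {ends : E → Sym2 V} {U : Finset V} {s t : V} {Vs : Finset V}

/-- `m` is antitone in `A`. -/
lemma mEv_anti_left {A A' : Finset V} (h : A ⊆ A') (W : Finset V) :
    mEv ends U s t Vs A' W ⊆ mEv ends U s t Vs A W := by
  rintro ω ⟨h1, h2, h3, h4⟩
  refine ⟨h1, h2, fun hc => h3 ?_, fun hc => h4 (connSet_mono_right h hc)⟩
  exact connSet_mono_right (Finset.union_subset_union_left (Finset.union_subset_union_right h)) hc

/-- `j` is antitone in `W`. -/
lemma jEv_anti_right (A : Finset V) (𝒰 : Finset (Finset V)) {W W' : Finset V} (h : W ⊆ W') :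
    jEv ends U s t Vs A 𝒰 W' ⊆ jEv ends U s t Vs A 𝒰 W := by
  rintro ω ⟨h1, h2, h3, h4⟩
  refine ⟨h1, h2, fun hc => h3 (connSet_mono_right (Finset.union_subset_union_right h) hc),
    fun hc => h4 (connSet_mono_right h hc)⟩

/-- **(F2′)** `j` is monotone under refining the blocks: if every block of `𝒰` lies in a block
of `𝒰'` and every block of `𝒰'` contains a block of `𝒰`, then `j(A, 𝒰, W) ⊆ j(A, 𝒰', W)`. -/
lemma jEv_mono_blocks (A : Finset V) {𝒰 𝒰' : Finset (Finset V)}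
    (h1 : ∀ B ∈ 𝒰, ∃ B' ∈ 𝒰', B ⊆ B') (h2 : ∀ B' ∈ 𝒰', ∃ B ∈ 𝒰, B ⊆ B') (W : Finset V) :
    jEv ends U s t Vs A 𝒰 W ⊆ jEv ends U s t Vs A 𝒰' W := by
  rintro ω ⟨hS, hv, h3, h4⟩
  refine ⟨fun B' hB' => ?_, fun v hv' => connB_mono_blocks h1 (hv v hv'), h3, h4⟩
  obtain ⟨B, hB, hBB'⟩ := h2 B' hB'
  exact connSetB_mono_right hBB' (connSetB_mono_blocks h1 (hS B hB))

/-- `a` is empty when `s` lies in a frontier set. -/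
lemma aEv_eq_empty_of_mem_s {A W : Finset V} (h : s ∈ A ∪ W) : aEv ends U s t Vs A W = ∅ := by
  ext ω
  simp only [Set.mem_empty_iff_false, iff_false]
  rintro ⟨_, _, h3, _, _⟩
  refine h3 ⟨s, Finset.mem_singleton_self s, s, ?_, conn_refl _ _ _⟩
  rw [Finset.union_assoc]
  exact Finset.mem_union_right _ h

/-- `a` is empty when an observed vertex lies in a frontier set. -/
lemma aEv_eq_empty_of_mem_v {A W : Finset V} {v : V} (hv : v ∈ Vs) (h : v ∈ A ∪ W) :
    aEv ends U s t Vs A W = ∅ := by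
  ext ω
  simp only [Set.mem_empty_iff_false, iff_false]
  rintro ⟨h1, _, h3, _, _⟩
  refine h3 ⟨s, Finset.mem_singleton_self s, v, ?_, conn_symm (h1 v hv)⟩
  rw [Finset.union_assoc]
  exact Finset.mem_union_right _ h

/-- `a` is empty when the two frontier sets meet. -/
lemma aEv_eq_empty_of_overlap {A W : Finset V} {z : V} (hA : z ∈ A) (hW : z ∈ W) :
    aEv ends U s t Vs A W = ∅ := by
  ext ω
  simp only [Set.mem_empty_iff_false, iff_false]
  rintro ⟨_, _, _, _, h5⟩
  exact h5 ⟨z, hW, z, hA, conn_refl _ _ _⟩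

/-- `b` is empty when `t` lies in a block or in the `w`-frontier. -/
lemma bEv_eq_empty_of_mem_t {𝒰 : Finset (Finset V)} {W : Finset V} (h : t ∈ unionB 𝒰 ∪ W) :
    bEv ends U s t Vs 𝒰 W = ∅ := by
  ext ω
  simp only [Set.mem_empty_iff_false, iff_false]
  rintro ⟨_, _, h3, _, _⟩
  refine h3 ⟨t, Finset.mem_singleton_self t, t, ?_, conn_refl _ _ _⟩
  rw [Finset.union_assoc]
  exact Finset.mem_union_right _ h

/-- `b` is empty when a block meets the `w`-frontier. -/
lemma bEv_eq_empty_of_overlap {𝒰 : Finset (Finset V)} {W : Finset V} {z : V} (hA : z ∈ unionB 𝒰)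
    (hW : z ∈ W) : bEv ends U s t Vs 𝒰 W = ∅ := by
  ext ω
  simp only [Set.mem_empty_iff_false, iff_false]
  rintro ⟨_, _, _, _, h5⟩
  exact h5 ⟨z, hA, z, hW, conn_refl _ _ _⟩

end Cells

/-! ## The glue: a free frontier vertex of `j` replaced by its open neighbours -/

section Glue

variable {V : Type*} {E : Type*} [Fintype E] [DecidableEq V] {ends : E → Sym2 V} {U : Finset V}
  {z : V} {ω : Config E} {s t : V} {Vs : Finset V}

/-- **(F2″) The glue inclusion**: for `z ∈ U`, `z ≠ s, t`, `z ∉ W`, the cell `j` of `G[U ∖ z]`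
with `z` replaced by its open neighbours inside the frontier is contained in the cell `j` of
`G[U]`, pointwise in the configuration. -/
lemma jEv_glue (hzU : z ∈ U) (hzs : z ≠ s) (hzt : z ≠ t) {A : Finset V}
    (𝒰 : Finset (Finset V)) {W : Finset V} (hzW : z ∉ W)
    (h : ω ∈ jEv ends (U \ {z}) s t Vs (A.erase z ∪ frontier ends U {z} ω) 𝒰 W) :
    ω ∈ jEv ends U s t Vs A 𝒰 W := by
  obtain ⟨h1, h2, h3, h4⟩ := h
  have hmem : ∀ x, x ∈ ({s} : Finset V) ∪ A ∪ W → x ≠ z →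
      x ∈ ({s} : Finset V) ∪ (A.erase z ∪ frontier ends U {z} ω) ∪ W := by
    intro x hx hxz
    simp only [Finset.mem_union, Finset.mem_singleton, Finset.mem_erase] at hx ⊢
    tauto
  -- reaching `z` in `G[U]` means reaching a revealed vertex in `G[U ∖ z]`
  have hz : ∀ x, x ≠ z → Conn ends (induced ends (↑U) ω) x z →
      ∃ y ∈ frontier ends U {z} ω, Conn ends (induced ends (↑(U \ {z})) ω) x y :=
    fun x hxz hc => (conn_z_iff hzU hxz).1 hc
  refine ⟨fun B hB => ?_, fun v hv => connB_of_sdiff (h2 v hv), ?_, ?_⟩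
  · obtain ⟨x, hx, y, hy, hxy⟩ := h1 B hB
    exact ⟨x, hx, y, hy, connB_of_sdiff hxy⟩
  · rintro ⟨t', ht', x, hx, htx⟩
    rw [Finset.mem_singleton] at ht'
    subst ht'
    by_cases hxz : x = z
    · subst hxz
      obtain ⟨y, hy, hty⟩ := hz t' hzt.symm htx
      exact h3 ⟨t', Finset.mem_singleton_self t', y,
        Finset.mem_union_left _ (Finset.mem_union_right _ (Finset.mem_union_right _ hy)), hty⟩
    · rcases conn_sdiff_or_conn_z (z := z) htx with h' | h'
      · exact h3 ⟨t', Finset.mem_singleton_self t', x, hmem x hx hxz, h'⟩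
      · obtain ⟨y, hy, hty⟩ := hz t' hzt.symm h'
        exact h3 ⟨t', Finset.mem_singleton_self t', y,
          Finset.mem_union_left _ (Finset.mem_union_right _ (Finset.mem_union_right _ hy)), hty⟩
  · rintro ⟨x, hx, w, hw, hxw⟩
    have hwz : w ≠ z := fun h => hzW (h ▸ hw)
    have hmem' : ∀ x, x ∈ ({s} : Finset V) ∪ A → x ≠ z →
        x ∈ ({s} : Finset V) ∪ (A.erase z ∪ frontier ends U {z} ω) := by
      intro x hx hxz
      simp only [Finset.mem_union, Finset.mem_singleton, Finset.mem_erase] at hx ⊢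
      tauto
    by_cases hxz : x = z
    · subst hxz
      obtain ⟨y, hy, hwy⟩ := hz w hwz (conn_symm hxw)
      exact h4 ⟨y, Finset.mem_union_right _ (Finset.mem_union_right _ hy), w, hw, conn_symm hwy⟩
    · rcases conn_sdiff_or_conn_z (z := z) hxw with h' | h'
      · exact h4 ⟨x, hmem' x hx hxz, w, hw, h'⟩
      · obtain ⟨y, hy, hwy⟩ := hz w hwz (conn_trans (conn_symm hxw) h')
        exact h4 ⟨y, Finset.mem_union_right _ (Finset.mem_union_right _ hy), w, hw, conn_symm hwy⟩

end Glue

end BlockFamily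

end Summit.Ventures.PercRepro2
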